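import Summits.Ventures.PercRepro.ProfilePointedCircuitClassesStarSharp
import Summits.Ventures.PercRepro.ProfilePointedCircuitClassesStarSharpM
import Summits.Ventures.PercRepro.ProfilePointedCircuitClassesStarSevenFromSharpC

/-!
# PercRepro — (★)₉ ON EVERY NINE-POINT MATROID WITH A SERIES PAIR
(p5, gen 56; `proofs/P5-GM1.md` §84 ADD 2)

`starNine_of_seriesPair`: on a coloop-free matroid with `#E = 9`, `ρ(E) = 5`, a series pair `{b, b′}` through whose
second point `b′` no further series pair passes, and `e ≠ f` outside the pair, `in_4(e) ≤ in_4(f) + thru_4({e, f})`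
— the statement `StarNine` of §77 at every such instance.  Proof: the exact split of (★) along the series pair
(`star_of_sharp_of_star_minor`, §79(b)): the Sharp part is `starNineSharp_holds`, and (★) one level down is
`starSeven_of_seriesExt` on the seven-point minor `N ／ b ∖ b′` (coloop-free by `rk_erase_minor_eq_of_seriesPair`,
with `b, b′` themselves as the two spare points).
-/

open scoped Matroid

namespace PercRepro.Cogirth

open Finset ThmH Skew Shadow Profile

open Classical

variable {α : Type} [DecidableEq α] {N : Matroid α} [N.Finite]

section StarNineOfSeriesPair

/-- **(★)₉ WITH A SERIES PAIR**: `in_4(e) ≤ in_4(f) + thru_4({e, f})` on every coloop-free nine-point rank-5 matroid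
with a series pair `{b, b′}` (no further series pair through `b′`) and `e ≠ f` outside the pair. -/
theorem starNine_of_seriesPair (hn : (gr N).card = 9) (hR : rk N (gr N) = 5)
    (hcf : ∀ x ∈ gr N, rk N ((gr N).erase x) = 5) {b b' e f : α} (h : SeriesPair N b b')
    (hno : ∀ x ∈ gr N, x ≠ b → ¬ SeriesPair N b' x) (he : e ∈ gr N) (hf : f ∈ gr N) (hef : e ≠ f)
    (heb : e ≠ b) (heb' : e ≠ b') (hfb : f ≠ b) (hfb' : f ≠ b') :
    inCount N 4 e ≤ inCount N 4 f + thruCount N 4 {e, f} := by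
  have hbb' : b ≠ b' := h.2.2.1
  have hcf' : ∀ x ∈ gr N, rk N ((gr N).erase x) = rk N (gr N) := fun x hx => by rw [hcf x hx, hR]
  -- the seven-point minor
  have hgr := gr_minor_of_seriesPair (N := N) b b'
  have hn7 : (gr ((N ／ ({b} : Set α)) ＼ ({b'} : Set α))).card = 7 := by
    have := card_gr_minor_add_two_of_seriesPair (N := N) h
    rw [hn] at this; omega
  have hR4 : rk ((N ／ ({b} : Set α)) ＼ ({b'} : Set α)) (gr ((N ／ ({b} : Set α)) ＼ ({b'} : Set α))) = 4 := by
    have := rk_gr_minor_add_one_of_seriesPair (N := N) h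
    rw [hR] at this; omega
  have hcf7 : ∀ x ∈ gr ((N ／ ({b} : Set α)) ＼ ({b'} : Set α)),
      rk ((N ／ ({b} : Set α)) ＼ ({b'} : Set α)) ((gr ((N ／ ({b} : Set α)) ＼ ({b'} : Set α))).erase x) = 4 := by
    intro x hx
    rw [rk_erase_minor_eq_of_seriesPair h hcf' hno x hx, hR4]
  have hdis : Disjoint ((N ／ ({b} : Set α)) ＼ ({b'} : Set α)).E {b, b'} := by
    rw [Set.disjoint_left]
    intro z hz hz'
    have hzg : z ∈ gr ((N ／ ({b} : Set α)) ＼ ({b'} : Set α)) := by rw [← mem_coe, coe_gr]; exact hz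
    rw [hgr, mem_erase, mem_erase] at hzg
    rcases hz' with rfl | rfl
    · exact hzg.2.1 rfl
    · exact hzg.1 rfl
  have heM : e ∈ gr ((N ／ ({b} : Set α)) ＼ ({b'} : Set α)) := by
    rw [hgr]; exact mem_erase.2 ⟨heb', mem_erase.2 ⟨heb, he⟩⟩
  have hfM : f ∈ gr ((N ／ ({b} : Set α)) ＼ ({b'} : Set α)) := by
    rw [hgr]; exact mem_erase.2 ⟨hfb', mem_erase.2 ⟨hfb, hf⟩⟩
  have hminor := starSeven_of_seriesExt hdis hn7 hR4 hcf7 hbb' heM hfM hef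
  have hsharp := starNineSharp_holds (α := α) N hn hR hcf b b' e f h he hf hef heb heb' hfb hfb'
  exact star_of_sharp_of_star_minor h (k := 3) (by rw [hn, hR]) heb heb' hfb hfb' hsharp hminor

end StarNineOfSeriesPair

end PercRepro.Cogirth
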